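import Summits.QuantumFields.YangMills.Theorems.FemtoTransferGapSlabGround
import HarnessLib

/-!
# Slab currency, fixed-lattice support II: the vacuum proxy — `R(Φ_m) → λ₀(L, β)` as `m → ∞` (power method at fixed lattice)

Support module for route `LuscherReduction` (QuantumFields ∕ YangMills; rung leaf R2b1 `FemtoGapOfRecord`), crux `RunningReduction`
(stmt-QuantumFields-19978), owner input №3 «slab currency» (planner ym-beyond-p1 g15): the target `tendsto_rayleigh_slabGround` of
`Sketch-RED-slab.lean` — the Rayleigh quotients of the free-boundary slabs `Φ_m = K_β^m 1` increase to the top zero-flux transfer value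
`levelValue su2Rep L β 0` at FIXED lattice, for every `β ≥ 0` (the Sketch asks `β ≥ 1`).  Fleet service by seat ym-infvol-p2.

THE PROOF (elementary; no Perron–Frobenius, no compactness of the operator).  Write `T = K_β`, `N_m = ‖Φ_m‖²`, `Q_m = ⟨Φ_m, TΦ_m⟩`,
`b_m = Q_m / N_m = R(Φ_m)`.
* §1 algebra of physical test functions: sums and multiples are physical; `⟨Tf, g⟩ = ⟨f, Tg⟩` (Fubini + symmetry of the kernel,
  `transferKernel_su2Rep_symm`); bilinearity; the two Cauchy–Schwarz inequalities `⟨f,g⟩² ≤ ‖f‖²‖g‖²` and, from positive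
  semi-definiteness (`qform_su2Rep_self_nonneg`, `β ≥ 0`), `⟨f,Tg⟩² ≤ ⟨f,Tf⟩⟨g,Tg⟩`.
* §2 iterates `T^j ψ` of a physical `ψ`: physical, `⟨T^iψ, T^jψ⟩ = ⟨ψ, T^{i+j}ψ⟩`, and the domination `|T^jψ| ≤ c Φ_j` for `|ψ| ≤ c`
  (the kernel is pointwise positive), hence `‖T^jψ‖² ≤ c² N_j`.
* §3 the theorem: `Q_m = ⟨Φ_{m+1},Φ_m⟩`, `N_{m+1} = ⟨Φ_{m+1},TΦ_m⟩`, so the two Cauchy–Schwarz inequalities give `b_m ≤ b_{m+1}`; `b_m ≤ λ₀`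
  (`rayleigh_le_levelValue_zero`), so `b_m ↑ B ≤ λ₀`; moreover `N_{m+1} ≤ B Q_m ≤ B² N_m`, so `N_m ≤ B^{2m}`.  For any physical `ψ` with
  `|ψ| ≤ c`, `‖ψ‖² > 0`: the dyadic Cauchy–Schwarz chain `R(ψ)^{2^{n+1}} ≤ ‖T^{2^n}ψ‖²/‖ψ‖² ≤ c² B^{2^{n+1}}/‖ψ‖²` forces `R(ψ) ≤ B`; hence
  `λ₀ ≤ B` (`levelValue_zero_le_of_forall_rayleigh_le`), `B = λ₀`, and `b_m → λ₀`.

HONEST FRAMING: femto-universe infrastructure at fixed lattice; no renormalisation-group content; nothing here bears on infinite volume or the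
Clay gap.  References: M. Reed, B. Simon IV (1978) Thm XIII.1; E. Seiler, LNP 159 (1982) §3; M. Lüscher, NPB 219 (1983).
-/

set_option autoImplicit false

noncomputable section

open MeasureTheory Filter Topology Real
open Literature.MathematicalPhysics.QuantumFieldTheory
open Literature.MathematicalPhysics.QuantumLattice
open Literature.Analysis.OperatorTheory.YMMatrixModel

namespace Summit.QuantumFields.YangMills.Theorems.FemtoTransferGap

/-! ### §1. Algebra of physical test functions; symmetry of `K_β`; the two Cauchy–Schwarz inequalities -/

section Algebra

variable {G : Type*} [Group G] [MeasurableSpace G]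

/-- Sums of physical zero-flux test functions are physical. [folklore] -/
theorem IsPhys.add {L : ℕ} {ψ φ : GaugeConfig 3 L G → ℝ} (hψ : IsPhys ψ) (hφ : IsPhys φ) : IsPhys (ψ + φ) where
  measurable := hψ.measurable.add hφ.measurable
  bounded := by
    obtain ⟨C, hC⟩ := hψ.bounded
    obtain ⟨D, hD⟩ := hφ.bounded
    exact ⟨C + D, fun U => (abs_add_le _ _).trans (add_le_add (hC U) (hD U))⟩
  gaugeInv := fun g U => by simp only [Pi.add_apply, hψ.gaugeInv g U, hφ.gaugeInv g U]
  zeroFlux := fun k z hz U => by simp only [Pi.add_apply, hψ.zeroFlux k z hz U, hφ.zeroFlux k z hz U]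

/-- Real multiples of physical zero-flux test functions are physical. [folklore] -/
theorem IsPhys.smul {L : ℕ} {ψ : GaugeConfig 3 L G → ℝ} (hψ : IsPhys ψ) (a : ℝ) : IsPhys (a • ψ) where
  measurable := hψ.measurable.const_mul a
  bounded := by
    obtain ⟨C, hC⟩ := hψ.bounded
    exact ⟨|a| * C, fun U => by
      rw [Pi.smul_apply, smul_eq_mul, abs_mul]; exact mul_le_mul_of_nonneg_left (hC U) (abs_nonneg _)⟩
  gaugeInv := fun g U => by simp only [Pi.smul_apply, hψ.gaugeInv g U]
  zeroFlux := fun k z hz U => by simp only [Pi.smul_apply, hψ.zeroFlux k z hz U]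

end Algebra

section Forms

variable {L : ℕ} [NeZero L]

/-- `l2` is symmetric. [folklore] -/
theorem l2_comm {G : Type*} [Group G] [TopologicalSpace G] [IsTopologicalGroup G] [CompactSpace G] [MeasurableSpace G]
    [BorelSpace G] (ψ φ : GaugeConfig 3 L G → ℝ) : l2 ψ φ = l2 φ ψ := by
  unfold l2
  simp only [mul_comm]

/-- `‖ψ‖² ≥ 0`. [folklore] -/
theorem l2_self_nonneg {G : Type*} [Group G] [TopologicalSpace G] [IsTopologicalGroup G] [CompactSpace G] [MeasurableSpace G]
    [BorelSpace G] (ψ : GaugeConfig 3 L G → ℝ) : 0 ≤ l2 ψ ψ :=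
  integral_nonneg fun _ => mul_self_nonneg _

/-- `⟨f, g⟩ > 0` for physical `f ≥ c > 0`, `g ≥ d > 0`. [folklore] -/
theorem l2_pos_of_le {G : Type*} [Group G] [TopologicalSpace G] [IsTopologicalGroup G] [CompactSpace G] [MeasurableSpace G]
    [BorelSpace G] {f g : GaugeConfig 3 L G → ℝ} (hf : IsPhys f) (hg : IsPhys g) {c d : ℝ} (hc : 0 < c) (hd : 0 < d)
    (hcf : ∀ U, c ≤ f U) (hdg : ∀ U, d ≤ g U) : 0 < l2 f g := by
  have h : ∫ _U, c * d ∂configMeasure G L ≤ l2 f g :=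
    integral_mono (integrable_const _) (hf.integrable_mul hg) fun U =>
      mul_le_mul (hcf U) (hdg U) hd.le (hc.le.trans (hcf U))
  have hcd : ∫ _U, c * d ∂configMeasure G L = c * d := by simp
  rw [hcd] at h
  exact (mul_pos hc hd).trans_le h

/-- **Cauchy–Schwarz in `L²`** for physical test functions: `⟨f,g⟩² ≤ ‖f‖² ‖g‖²` (discriminant of `t ↦ ‖f + t g‖² ≥ 0`). [folklore] -/
theorem sq_l2_le {G : Type*} [Group G] [TopologicalSpace G] [IsTopologicalGroup G] [CompactSpace G] [MeasurableSpace G]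
    [BorelSpace G] {f g : GaugeConfig 3 L G → ℝ} (hf : IsPhys f) (hg : IsPhys g) :
    l2 f g ^ 2 ≤ l2 f f * l2 g g := by
  have hquad : ∀ t : ℝ, 0 ≤ l2 g g * (t * t) + 2 * l2 f g * t + l2 f f := by
    intro t
    have h0 : 0 ≤ l2 (f + t • g) (f + t • g) := l2_self_nonneg _
    have hexp : l2 (f + t • g) (f + t • g) = l2 g g * (t * t) + 2 * l2 f g * t + l2 f f := by
      rw [l2_add_left hf (hg.smul t) (hf.add (hg.smul t)), l2_smul_left, l2_comm f (f + t • g),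
        l2_comm g (f + t • g), l2_add_left hf (hg.smul t) hf, l2_add_left hf (hg.smul t) hg, l2_smul_left, l2_smul_left,
        l2_comm g f]
      ring
    rwa [hexp] at h0
  have hd := discrim_le_zero hquad
  rw [discrim] at hd
  nlinarith [hd]

/-- **`⟨ψ, K_β φ⟩ = ⟨ψ, Tφ⟩_{L²}`**: the transfer form is the `L²` pairing with the transfer operator applied to the second argument
(pull `ψ(U)` out of the inner integral; no Fubini). [folklore] -/
theorem qform_eq_l2_transferApply (β : ℝ) (ψ φ : GaugeConfig 3 L SU2 → ℝ) :
    qform su2Rep β ψ φ = l2 ψ (transferApply β φ) := by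
  unfold qform l2
  refine integral_congr_ae (ae_of_all _ fun U => ?_)
  simp only [transferApply_apply, mul_assoc]
  exact integral_const_mul _ _

/-- `⟨K_β f, g⟩_{L²} = ⟨g, K_β f⟩`. [folklore] -/
theorem l2_transferApply_left (β : ℝ) (f g : GaugeConfig 3 L SU2 → ℝ) :
    l2 (transferApply β f) g = qform su2Rep β g f := by
  rw [l2_comm, qform_eq_l2_transferApply]

/-- **The `SU(2)` transfer form is symmetric** on physical test functions (Fubini on the product space, symmetry of the kernel
`transferKernel_su2Rep_symm`). [cite: SeilerLNP1982, §3] -/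
theorem qform_su2Rep_comm (β : ℝ) {ψ φ : GaugeConfig 3 L SU2 → ℝ} (hψ : IsPhys ψ) (hφ : IsPhys φ) :
    qform su2Rep β ψ φ = qform su2Rep β φ ψ := by
  haveI : SecondCountableTopology SU2 := secondCountableTopology_su2
  rw [qform_eq_integral_prod su2Rep continuous_su2Rep β hψ hφ, qform_eq_integral_prod su2Rep continuous_su2Rep β hφ hψ,
    ← integral_prod_swap]
  refine integral_congr_ae (ae_of_all _ fun p => ?_)
  simp only [Prod.fst_swap, Prod.snd_swap, transferKernel_su2Rep_symm β p.2 p.1]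
  ring

/-- **`K_β` is symmetric on physical test functions**: `⟨K_β f, g⟩ = ⟨f, K_β g⟩`. [cite: SeilerLNP1982, §3] -/
theorem l2_transferApply_comm (β : ℝ) {f g : GaugeConfig 3 L SU2 → ℝ} (hf : IsPhys f) (hg : IsPhys g) :
    l2 (transferApply β f) g = l2 f (transferApply β g) := by
  rw [l2_transferApply_left, ← qform_eq_l2_transferApply, qform_su2Rep_comm β hg hf]

/-- The transfer form is additive in its first argument (physical test functions). [folklore] -/
theorem qform_add_left (β : ℝ) {ψ ψ' φ : GaugeConfig 3 L SU2 → ℝ} (hψ : IsPhys ψ) (hψ' : IsPhys ψ') (hφ : IsPhys φ) :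
    qform su2Rep β (ψ + ψ') φ = qform su2Rep β ψ φ + qform su2Rep β ψ' φ := by
  simp only [qform_eq_l2_transferApply]
  exact l2_add_left hψ hψ' (isPhys_transferApply β hφ)

/-- The transfer form is homogeneous in its first argument. [folklore] -/
theorem qform_smul_left (β a : ℝ) (ψ φ : GaugeConfig 3 L SU2 → ℝ) :
    qform su2Rep β (a • ψ) φ = a * qform su2Rep β ψ φ := by
  simp only [qform_eq_l2_transferApply]
  exact l2_smul_left a ψ _

/-- **Cauchy–Schwarz for the positive semi-definite transfer form** (`β ≥ 0`, physical test functions):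
`⟨f, K_β g⟩² ≤ ⟨f, K_β f⟩ ⟨g, K_β g⟩`. [cite: ReedSimonIV1978, Thm. XIII.1] -/
theorem sq_qform_le {β : ℝ} (hβ : 0 ≤ β) {f g : GaugeConfig 3 L SU2 → ℝ} (hf : IsPhys f) (hg : IsPhys g) :
    qform su2Rep β f g ^ 2 ≤ qform su2Rep β f f * qform su2Rep β g g := by
  have hquad : ∀ t : ℝ, 0 ≤ qform su2Rep β g g * (t * t) + 2 * qform su2Rep β f g * t + qform su2Rep β f f := by
    intro t
    have h0 : 0 ≤ qform su2Rep β (f + t • g) (f + t • g) := qform_su2Rep_self_nonneg hβ (hf.add (hg.smul t))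
    have hexp : qform su2Rep β (f + t • g) (f + t • g) =
        qform su2Rep β g g * (t * t) + 2 * qform su2Rep β f g * t + qform su2Rep β f f := by
      rw [qform_add_left β hf (hg.smul t) (hf.add (hg.smul t)), qform_smul_left,
        qform_su2Rep_comm β hf (hf.add (hg.smul t)), qform_su2Rep_comm β hg (hf.add (hg.smul t)),
        qform_add_left β hf (hg.smul t) hf, qform_add_left β hf (hg.smul t) hg, qform_smul_left, qform_smul_left,
        qform_su2Rep_comm β hg hf]
      ring
    rwa [hexp] at h0
  have hd := discrim_le_zero hquad
  rw [discrim] at hd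
  nlinarith [hd]

/-! ### §2. Iterates `K_β^j ψ` of a physical test function -/

/-- Iterates of the transfer operator on a physical test function are physical. [folklore] -/
theorem isPhys_iterate_transferApply (β : ℝ) {ψ : GaugeConfig 3 L SU2 → ℝ} (hψ : IsPhys ψ) (j : ℕ) :
    IsPhys ((transferApply (L := L) β)^[j] ψ) := by
  induction j with
  | zero => simpa using hψ
  | succ j ih => rw [Function.iterate_succ_apply']; exact isPhys_transferApply β ih

/-- **Moments depend only on the total power**: `⟨K^i ψ, K^j ψ⟩ = ⟨ψ, K^{i+j} ψ⟩` (symmetry of `K_β`, induction). [folklore] -/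
theorem l2_iterate_iterate (β : ℝ) {ψ : GaugeConfig 3 L SU2 → ℝ} (hψ : IsPhys ψ) (i j : ℕ) :
    l2 ((transferApply (L := L) β)^[i] ψ) ((transferApply β)^[j] ψ) = l2 ψ ((transferApply β)^[i + j] ψ) := by
  induction i generalizing j with
  | zero => simp
  | succ i ih =>
    rw [Function.iterate_succ_apply', l2_transferApply_comm β (isPhys_iterate_transferApply β hψ i)
      (isPhys_iterate_transferApply β hψ j), ← Function.iterate_succ_apply' (transferApply β) j, ih (j + 1)]
    congr 2
    omega

/-- **Domination by the vacuum proxies**: `|K^j ψ| ≤ c Φ_j` pointwise when `|ψ| ≤ c` (the kernel is pointwise positive). [folklore] -/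
theorem abs_iterate_transferApply_le (β : ℝ) {ψ : GaugeConfig 3 L SU2 → ℝ} (hψ : IsPhys ψ) {c : ℝ} (hc : ∀ U, |ψ U| ≤ c)
    (j : ℕ) (U : GaugeConfig 3 L SU2) : |(transferApply (L := L) β)^[j] ψ U| ≤ c * slabGround β j U := by
  induction j generalizing U with
  | zero => simpa using hc U
  | succ j ih =>
    have hj := isPhys_iterate_transferApply (L := L) β hψ j
    have hΦ := isPhys_slabGround (L := L) β j
    obtain ⟨C, hC⟩ := hj.bounded
    obtain ⟨D, hD⟩ := hΦ.bounded
    rw [Function.iterate_succ_apply', slabGround_succ, transferApply_apply, transferApply_apply]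
    calc |∫ V, transferKernel su2Rep β U V * (transferApply β)^[j] ψ V ∂configMeasure SU2 L|
        ≤ ∫ V, |transferKernel su2Rep β U V * (transferApply β)^[j] ψ V| ∂configMeasure SU2 L := abs_integral_le_integral_abs
      _ ≤ ∫ V, transferKernel su2Rep β U V * (c * slabGround β j V) ∂configMeasure SU2 L := by
          refine integral_mono (integrable_transferKernel_mul β U hj.measurable hC).abs
            (integrable_transferKernel_mul β U (hΦ.measurable.const_mul c) (C := |c| * D) fun V => ?_) fun V => ?_
          · rw [abs_mul]; exact mul_le_mul_of_nonneg_left (hD V) (abs_nonneg _)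
          · have hK := transferKernel_pos su2Rep β U V
            rw [abs_mul, abs_of_pos hK]
            exact mul_le_mul_of_nonneg_left (ih V) hK.le
      _ = c * ∫ V, transferKernel su2Rep β U V * slabGround β j V ∂configMeasure SU2 L := by
          rw [← integral_const_mul]
          exact integral_congr_ae (ae_of_all _ fun V => by ring)

/-- `‖K^j ψ‖² ≤ c² ‖Φ_j‖²` when `|ψ| ≤ c`. [folklore] -/
theorem l2_iterate_le (β : ℝ) {ψ : GaugeConfig 3 L SU2 → ℝ} (hψ : IsPhys ψ) {c : ℝ} (hc : ∀ U, |ψ U| ≤ c) (j : ℕ) :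
    l2 ((transferApply (L := L) β)^[j] ψ) ((transferApply β)^[j] ψ) ≤ c ^ 2 * l2 (slabGround (L := L) β j) (slabGround β j) := by
  have hj := isPhys_iterate_transferApply (L := L) β hψ j
  have hΦ := isPhys_slabGround (L := L) β j
  unfold l2
  rw [← integral_const_mul]
  refine integral_mono (hj.integrable_mul hj) ((hΦ.integrable_mul hΦ).const_mul _) fun U => ?_
  have h := abs_iterate_transferApply_le β hψ hc j U
  have h0 : 0 ≤ c * slabGround β j U := (abs_nonneg _).trans h
  calc (transferApply β)^[j] ψ U * (transferApply β)^[j] ψ U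
      = |(transferApply β)^[j] ψ U| * |(transferApply β)^[j] ψ U| := (abs_mul_abs_self _).symm
    _ ≤ (c * slabGround β j U) * (c * slabGround β j U) := mul_le_mul h h (abs_nonneg _) h0
    _ = c ^ 2 * (slabGround β j U * slabGround β j U) := by ring

/-! ### §3. The theorem -/

/-- **The vacuum proxy at fixed lattice: `R(Φ_m) → λ₀(L, β)`** as `m → ∞`, for every `L ≥ 1` and every `β ≥ 0` — the Rayleigh
quotients `⟨Φ_m, K_βΦ_m⟩/‖Φ_m‖²` of the free-boundary slabs `Φ_m = K_β^m 1` are non-decreasing, bounded by the top zero-flux transfer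
value `levelValue su2Rep L β 0`, and their limit dominates every physical Rayleigh quotient (dyadic Cauchy–Schwarz chain + domination by
`Φ_j` + growth `‖Φ_m‖² ≤ B^{2m}`), hence equals it. [cite: ReedSimonIV1978, Thm. XIII.1] -/
theorem tendsto_rayleigh_slabGround {β : ℝ} (hβ : 0 ≤ β) :
    Tendsto (fun m : ℕ => qform su2Rep β (slabGround (L := L) β m) (slabGround β m) /
        l2 (slabGround (L := L) β m) (slabGround β m)) atTop (𝓝 (levelValue su2Rep L β 0)) := by
  set Φ : ℕ → GaugeConfig 3 L SU2 → ℝ := slabGround (L := L) β with hΦ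
  -- basic facts about the vacuum proxies
  have hphys : ∀ m, IsPhys (Φ m) := fun m => isPhys_slabGround β m
  have hsucc : ∀ m, Φ (m + 1) = transferApply β (Φ m) := fun m => slabGround_succ β m
  have hNpos : ∀ m, 0 < l2 (Φ m) (Φ m) := fun m => l2_slabGround_pos β m
  have hQeq : ∀ m, qform su2Rep β (Φ m) (Φ m) = l2 (Φ (m + 1)) (Φ m) := fun m => by
    rw [hsucc, l2_transferApply_left]
  have hNeq : ∀ m, l2 (Φ (m + 1)) (Φ (m + 1)) = qform su2Rep β (Φ (m + 1)) (Φ m) := fun m => by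
    have h := l2_transferApply_left β (Φ m) (Φ (m + 1))
    rwa [← hsucc] at h
  have hQpos : ∀ m, 0 < qform su2Rep β (Φ m) (Φ m) := fun m => by
    obtain ⟨c, hc, hcle⟩ := exists_pos_le_slabGround (L := L) β (m + 1)
    obtain ⟨d, hd, hdle⟩ := exists_pos_le_slabGround (L := L) β m
    rw [hQeq]
    exact l2_pos_of_le (hphys _) (hphys _) hc hd hcle hdle
  -- the Rayleigh quotients `b m` are non-decreasing (two Cauchy–Schwarz inequalities)
  set b : ℕ → ℝ := fun m => qform su2Rep β (Φ m) (Φ m) / l2 (Φ m) (Φ m) with hb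
  have hstep : ∀ m, b m ≤ b (m + 1) := by
    intro m
    have h1 : qform su2Rep β (Φ m) (Φ m) ^ 2 ≤ l2 (Φ (m + 1)) (Φ (m + 1)) * l2 (Φ m) (Φ m) := by
      rw [hQeq]; exact sq_l2_le (hphys _) (hphys _)
    have h2 : l2 (Φ (m + 1)) (Φ (m + 1)) ^ 2 ≤ qform su2Rep β (Φ (m + 1)) (Φ (m + 1)) * qform su2Rep β (Φ m) (Φ m) := by
      rw [hNeq]; exact sq_qform_le hβ (hphys _) (hphys _)
    have hX : 0 < qform su2Rep β (Φ m) (Φ m) * l2 (Φ (m + 1)) (Φ (m + 1)) := mul_pos (hQpos m) (hNpos (m + 1))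
    have hXY : (qform su2Rep β (Φ m) (Φ m) * l2 (Φ (m + 1)) (Φ (m + 1))) *
        (qform su2Rep β (Φ m) (Φ m) * l2 (Φ (m + 1)) (Φ (m + 1))) ≤
        (qform su2Rep β (Φ m) (Φ m) * l2 (Φ (m + 1)) (Φ (m + 1))) *
          (qform su2Rep β (Φ (m + 1)) (Φ (m + 1)) * l2 (Φ m) (Φ m)) := by
      calc _ = qform su2Rep β (Φ m) (Φ m) ^ 2 * l2 (Φ (m + 1)) (Φ (m + 1)) ^ 2 := by ring
        _ ≤ (l2 (Φ (m + 1)) (Φ (m + 1)) * l2 (Φ m) (Φ m)) *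
            (qform su2Rep β (Φ (m + 1)) (Φ (m + 1)) * qform su2Rep β (Φ m) (Φ m)) :=
            mul_le_mul h1 h2 (sq_nonneg _) (mul_nonneg (hNpos _).le (hNpos _).le)
        _ = _ := by ring
    have hle := le_of_mul_le_mul_left hXY hX
    show qform su2Rep β (Φ m) (Φ m) / l2 (Φ m) (Φ m) ≤ qform su2Rep β (Φ (m + 1)) (Φ (m + 1)) / l2 (Φ (m + 1)) (Φ (m + 1))
    rw [div_le_div_iff₀ (hNpos m) (hNpos (m + 1))]
    exact hle
  have hmono : Monotone b := monotone_nat_of_le_succ hstep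
  -- bounded by `λ₀`, hence convergent to `B = sup b ≤ λ₀`
  have hbTop : ∀ m, b m ≤ levelValue su2Rep L β 0 := fun m =>
    rayleigh_le_levelValue_zero su2Rep continuous_su2Rep β (hphys m) (hNpos m)
  have hbdd : BddAbove (Set.range b) := ⟨levelValue su2Rep L β 0, by rintro _ ⟨m, rfl⟩; exact hbTop m⟩
  set B : ℝ := ⨆ m, b m with hBdef
  have hconv : Tendsto b atTop (𝓝 B) := tendsto_atTop_ciSup hmono hbdd
  have hbB : ∀ m, b m ≤ B := fun m => le_ciSup hbdd m
  have hBtop : B ≤ levelValue su2Rep L β 0 := ciSup_le hbTop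
  have hB0 : 0 < B := lt_of_lt_of_le (div_pos (hQpos 0) (hNpos 0)) (hbB 0)
  -- growth of the norms: `‖Φ_m‖² ≤ B^{2m}`
  have hQN : ∀ m, qform su2Rep β (Φ m) (Φ m) ≤ B * l2 (Φ m) (Φ m) := fun m => by
    have h := hbB m
    rwa [show b m = qform su2Rep β (Φ m) (Φ m) / l2 (Φ m) (Φ m) from rfl, div_le_iff₀ (hNpos m)] at h
  have hNQ : ∀ m, l2 (Φ (m + 1)) (Φ (m + 1)) ≤ B * qform su2Rep β (Φ m) (Φ m) := by
    intro m
    have h2 : l2 (Φ (m + 1)) (Φ (m + 1)) ^ 2 ≤ qform su2Rep β (Φ (m + 1)) (Φ (m + 1)) * qform su2Rep β (Φ m) (Φ m) := by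
      rw [hNeq]; exact sq_qform_le hβ (hphys _) (hphys _)
    have h3 : l2 (Φ (m + 1)) (Φ (m + 1)) * l2 (Φ (m + 1)) (Φ (m + 1)) ≤
        l2 (Φ (m + 1)) (Φ (m + 1)) * (B * qform su2Rep β (Φ m) (Φ m)) := by
      calc _ = l2 (Φ (m + 1)) (Φ (m + 1)) ^ 2 := (sq _).symm
        _ ≤ qform su2Rep β (Φ (m + 1)) (Φ (m + 1)) * qform su2Rep β (Φ m) (Φ m) := h2
        _ ≤ (B * l2 (Φ (m + 1)) (Φ (m + 1))) * qform su2Rep β (Φ m) (Φ m) :=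
            mul_le_mul_of_nonneg_right (hQN (m + 1)) (hQpos m).le
        _ = _ := by ring
    exact le_of_mul_le_mul_left h3 (hNpos (m + 1))
  have hN0 : l2 (Φ 0) (Φ 0) = 1 := by
    simp [hΦ, slabGround_zero, l2]
  have hNgrow : ∀ m, l2 (Φ m) (Φ m) ≤ B ^ (2 * m) := by
    intro m
    induction m with
    | zero => simp [hN0]
    | succ m ih =>
      calc l2 (Φ (m + 1)) (Φ (m + 1)) ≤ B * qform su2Rep β (Φ m) (Φ m) := hNQ m
        _ ≤ B * (B * l2 (Φ m) (Φ m)) := mul_le_mul_of_nonneg_left (hQN m) hB0.le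
        _ ≤ B * (B * B ^ (2 * m)) := by gcongr
        _ = B ^ (2 * (m + 1)) := by ring
  -- every physical Rayleigh quotient is `≤ B`
  have hRay : ∀ ψ : GaugeConfig 3 L SU2 → ℝ, IsPhys ψ → 0 < l2 ψ ψ → qform su2Rep β ψ ψ ≤ B * l2 ψ ψ := by
    intro ψ hψ hψpos
    obtain ⟨c, hc⟩ := hψ.bounded
    -- norms of the iterates, their symmetry and domination
    have hM : ∀ j, l2 ((transferApply β)^[j] ψ) ((transferApply β)^[j] ψ) = l2 ψ ((transferApply β)^[2 * j] ψ) :=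
      fun j => by rw [l2_iterate_iterate β hψ j j, two_mul]
    have hchain : ∀ j, l2 ((transferApply β)^[j] ψ) ((transferApply β)^[j] ψ) ^ 2 ≤
        l2 ψ ψ * l2 ((transferApply β)^[2 * j] ψ) ((transferApply β)^[2 * j] ψ) := fun j => by
      rw [hM j]; exact sq_l2_le hψ (isPhys_iterate_transferApply β hψ (2 * j))
    have hdom : ∀ j, l2 ((transferApply β)^[j] ψ) ((transferApply β)^[j] ψ) ≤ c ^ 2 * B ^ (2 * j) := fun j =>
      (l2_iterate_le β hψ hc j).trans (mul_le_mul_of_nonneg_left (hNgrow j) (sq_nonneg c))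
    have hq1 : qform su2Rep β ψ ψ = l2 ψ ((transferApply β)^[1] ψ) := by
      rw [Function.iterate_one, qform_eq_l2_transferApply]
    -- the dyadic chain: `(q/‖ψ‖²)^{2^{n+1}} ≤ ‖T^{2^n}ψ‖² / ‖ψ‖²`
    set r : ℝ := qform su2Rep β ψ ψ / l2 ψ ψ with hr
    have hD : ∀ n : ℕ, r ^ (2 ^ (n + 1)) ≤
        l2 ((transferApply β)^[2 ^ n] ψ) ((transferApply β)^[2 ^ n] ψ) / l2 ψ ψ := by
      intro n
      induction n with
      | zero =>
        have h1 : qform su2Rep β ψ ψ ^ 2 ≤ l2 ψ ψ * l2 ((transferApply β)^[1] ψ) ((transferApply β)^[1] ψ) := by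
          rw [hq1]; exact sq_l2_le hψ (isPhys_iterate_transferApply β hψ 1)
        rw [show 2 ^ (0 + 1) = 2 by norm_num, pow_zero, hr, div_pow, div_le_div_iff₀ (pow_pos hψpos 2) hψpos]
        calc qform su2Rep β ψ ψ ^ 2 * l2 ψ ψ
            ≤ (l2 ψ ψ * l2 ((transferApply β)^[1] ψ) ((transferApply β)^[1] ψ)) * l2 ψ ψ :=
              mul_le_mul_of_nonneg_right h1 hψpos.le
          _ = l2 ((transferApply β)^[1] ψ) ((transferApply β)^[1] ψ) * l2 ψ ψ ^ 2 := by ring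
      | succ n ih =>
        have hnn : 0 ≤ r ^ (2 ^ (n + 1)) := Even.pow_nonneg ⟨2 ^ n, by ring⟩ r
        calc r ^ (2 ^ (n + 1 + 1)) = (r ^ (2 ^ (n + 1))) ^ 2 := by rw [← pow_mul]; ring
          _ ≤ (l2 ((transferApply β)^[2 ^ n] ψ) ((transferApply β)^[2 ^ n] ψ) / l2 ψ ψ) ^ 2 :=
              pow_le_pow_left₀ hnn ih 2
          _ = l2 ((transferApply β)^[2 ^ n] ψ) ((transferApply β)^[2 ^ n] ψ) ^ 2 / l2 ψ ψ ^ 2 := div_pow _ _ 2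
          _ ≤ (l2 ψ ψ * l2 ((transferApply β)^[2 * 2 ^ n] ψ) ((transferApply β)^[2 * 2 ^ n] ψ)) / l2 ψ ψ ^ 2 :=
              div_le_div_of_nonneg_right (hchain (2 ^ n)) (sq_nonneg _)
          _ = l2 ((transferApply β)^[2 ^ (n + 1)] ψ) ((transferApply β)^[2 ^ (n + 1)] ψ) / l2 ψ ψ := by
              rw [← pow_succ', sq, mul_div_mul_left _ _ hψpos.ne']
    -- combine with domination and growth: `(r/B)^{2^{n+1}} ≤ c² / ‖ψ‖²`
    have hfin : ∀ n : ℕ, (r / B) ^ (2 ^ (n + 1)) ≤ c ^ 2 / l2 ψ ψ := by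
      intro n
      have hk : 0 < B ^ (2 ^ (n + 1)) := pow_pos hB0 _
      rw [div_pow, div_le_iff₀ hk]
      calc r ^ 2 ^ (n + 1) ≤ l2 ((transferApply β)^[2 ^ n] ψ) ((transferApply β)^[2 ^ n] ψ) / l2 ψ ψ := hD n
        _ ≤ (c ^ 2 * B ^ (2 * 2 ^ n)) / l2 ψ ψ := div_le_div_of_nonneg_right (hdom (2 ^ n)) hψpos.le
        _ = c ^ 2 / l2 ψ ψ * B ^ 2 ^ (n + 1) := by rw [← pow_succ']; ring
    -- conclude `r ≤ B`
    rw [← div_le_iff₀ hψpos]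
    by_contra hlt
    rw [not_le] at hlt
    have hgt : 1 < r / B := by rw [lt_div_iff₀ hB0, one_mul]; exact hlt
    obtain ⟨k₀, hk₀⟩ := Filter.eventually_atTop.1
      ((tendsto_pow_atTop_atTop_of_one_lt hgt).eventually (eventually_gt_atTop (c ^ 2 / l2 ψ ψ)))
    have hle : k₀ ≤ 2 ^ (k₀ + 1) := (Nat.lt_two_pow_self).le.trans (Nat.pow_le_pow_right two_pos (Nat.le_succ _))
    exact absurd (hfin k₀) (not_le.mpr (hk₀ _ hle))
  -- hence `λ₀ ≤ B`, `B = λ₀`, and the Rayleigh quotients converge to `λ₀`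
  have htopB : levelValue su2Rep L β 0 ≤ B := levelValue_zero_le_of_forall_rayleigh_le su2Rep β hB0.le hRay
  rw [le_antisymm htopB hBtop]
  exact hconv

end Forms

end Summit.QuantumFields.YangMills.Theorems.FemtoTransferGap

end
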